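import Summits.RiemannHypothesis.RiemannHypothesis.Theses.SpectralTrace
import Summits.RiemannHypothesis.RiemannHypothesis.Theorems.SpectralTraceWindowTraceArchStubCausalCrystallisation
import Summits.RiemannHypothesis.RiemannHypothesis.Theorems.SpectralTraceWindowTraceArchStubSmearedWindowFormula
import Summits.RiemannHypothesis.RiemannHypothesis.Theorems.SpectralTraceWindowTraceArchStubStructureFunction
import Summits.RiemannHypothesis.RiemannHypothesis.Theorems.SpectralTraceWindowTraceArchStubXiAbsorption
import Summits.RiemannHypothesis.RiemannHypothesis.Theorems.SpectralTraceWindowTraceArchStubXiPhase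
import Summits.RiemannHypothesis.RiemannHypothesis.Theorems.SpectralTraceWindowTraceArchStubSmearedIntegrable
import Summits.RiemannHypothesis.RiemannHypothesis.Theorems.SpectralTraceWindowTraceArchStubCarrierTrace
import Summits.RiemannHypothesis.RiemannHypothesis.Theorems.SpectralTraceWindowTraceArchStubExcisedTrace
import Literature.NumberTheory.LFunctions.LagariasXiShiftHermiteBiehlerProofs
import Literature.NumberTheory.LFunctions.RiemannXiLogDeriv
import Literature.NumberTheory.LFunctions.WeilExplicitArchTermProofs
import HarnessLib

/-!
# Line `causal-level-sets` — RESHAPED skeleton (lead c1 cycle 2; lead c2 cycle 1: stubs 4a/4b/4d closed by landed theorems, composition factored through stub_carrierTrace / stub_excisedTrace) for the crux `WindowTraceArch`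
(stmt-RiemannHypothesis-11195, route `SpectralTrace`)

Stubs 1–3 of the planner's skeleton are LANDED (`stub_causalCrystallisation` p114539,
`stub_smearedWindowFormula` p100556, `stub_structureFunction` p119921). The load-bearing stub 4
(`stub_causalSurgeryDesign`: ONE smeared configuration synthesising `T_W − 2Lδ₀ + Σ_D e^{idx}` with a
FINITE excision set `D`) is replaced — see `work/stub4_analysis.md` (evidence on the crux item) — by the
ξ-ABSORBED, DOUBLY-TILTED design:

* `E(z) = e^{-iLz} · ξ(1/2 + h − iz) · E_R(z)`, `h > 1/2` (ξ-factor Hermite–Biehler UNCONDITIONALLY: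
  Lagarias 2005 Lemma 2.1, tree `lagarias2005_lemma_2_1_holds`), `E_R` the structure function of a
  configuration `R` (stub 3); its level set `Λ_α(E)` sums `ĝ` to
  `2L g(0) + (1/π)∫ ĝ Re ξ'/ξ(1/2+h+it) + Σ_R smeared` (stubs 1, 2), and
  `(1/π)∫ ĝ(t) Re ξ'/ξ(1/2+h+it) dt = W(g) − ∫ g m_h` EXACTLY on the window (STUB 4a, elementary in the
  half-plane of absolute convergence), `m_h(x) = (1 − e^{−h|x|})(2cosh(x/2) − e^{−|x|/2}/(1 − e^{−2|x|}))`;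
* the overshoot `2Lδ₀ + S_R − m_h` is removed by EXCISING A LEVEL SET WITH THE SAME TILT,
  `Λ_β(e^{−iLz}E_G)` (configuration `G`), which sums `ĝ` to `2L g(0) + Σ_G smeared`;
* so `Γ := Λ_α(E) \ Λ_β(e^{−iLz}E_G)` is a crux witness as soon as (a) `Λ_β(G̃) ⊆ Λ_α(E)` (phase
  integrality of `L s + ∫₀ˢ(Re ξ'/ξ + ΣP_R)` at the level points of the tilted `G`) and
  (b) `S_R − S_G = m_h` on the window (STUB 4c, the new hardest stub: an infinite
  interpolation–synthesis problem with NO δ₀ budget, a rich `k = 1` bottom and capacity ratio → 4).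

Stubs of this file: 1–3 (landed, restated and closed by the landed theorems), 4a `stub_xiAbsorption`,
4b `stub_xiPhase` (linear growth of ξ'/ξ on `Re s ≥ 3/4 + h/2 > 1` and the integral phase of
`t ↦ ξ(1/2+h+it)`), 4c `stub_doublyTiltedDesign` (HARDEST), 4d `stub_smearedIntegrable`
(integrability bookkeeping for splitting the stub-1 integral). Composition `WindowTraceArch_of` at the end.
-/

noncomputable section

open Complex Set MeasureTheory Filter
open scoped Real Topology

set_option linter.dupNamespace false

namespace Summit.RiemannHypothesis.RiemannHypothesis.Cruxes.WindowTraceArch.CausalLevelSets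

open Literature.NumberTheory.LFunctions
open Literature.Analysis.DeBrangesSpaces (IsHermiteBiehler sharp)
open Summit.RiemannHypothesis.RiemannHypothesis.Theses.SpectralTrace (WindowTraceArch)

/-! ### Stubs 1–3 (LANDED; restated verbatim, closed by the landed theorems) -/

/-- STUB 1 (landed p114539): causal crystallisation. -/
theorem stub_causalCrystallisation :
    ∀ (E : ℂ → ℂ) (L δ C : ℝ) (N : ℕ), IsHermiteBiehler E → 0 < δ →
      (∀ z : ℂ, -δ ≤ z.im → E z ≠ 0) →
      (∀ z : ℂ, -δ ≤ z.im → ‖deriv E z / E z‖ ≤ C * (1 + ‖z‖) ^ N) →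
      ∀ (α A : ℝ), A < 2 * L →
      ∀ h : ℝ → ℂ, IsWeilTest h → tsupport h ⊆ Icc (-A) A →
        HasSum
          (fun l : {t : ℝ // (cexp (((α - L * t : ℝ) : ℂ) * I) * E t).im = 0} =>
            weilMellin h (1 / 2 + ((l : ℝ) : ℂ) * I))
          ((1 / (π : ℂ)) * ∫ t : ℝ, weilMellin h (1 / 2 + (t : ℂ) * I) *
            (((L - (deriv E t / E t).im : ℝ)) : ℂ)) :=
  Summit.RiemannHypothesis.RiemannHypothesis.Theorems.SpectralTraceWindowTraceArch.stub_causalCrystallisation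

/-- STUB 2 (landed p100556): the smeared window formula. -/
theorem stub_smearedWindowFormula :
    ∀ (γ b : ℕ → ℝ) (δ B L : ℝ), 0 < δ → (∀ k, δ ≤ b k ∧ b k ≤ B) →
      Summable (fun k => 1 / (1 + (γ k) ^ 2)) →
      ∀ h : ℝ → ℂ, IsWeilTest h →
        HasSum
          (fun k => ∫ x : ℝ, h x * cexp (((γ k * x : ℝ) : ℂ) * I) * ((Real.exp (-(b k * |x|)) : ℝ) : ℂ))
          ((1 / (π : ℂ)) * (∫ t : ℝ, weilMellin h (1 / 2 + (t : ℂ) * I) *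
              (((L + ∑' k, b k / ((t - γ k) ^ 2 + (b k) ^ 2) : ℝ)) : ℂ)) - 2 * L * h 0) :=
  Summit.RiemannHypothesis.RiemannHypothesis.Theorems.SpectralTraceWindowTraceArch.stub_smearedWindowFormula

/-- STUB 3 (landed p119921): the structure function of a configuration. -/
theorem stub_structureFunction :
    ∀ (γ b : ℕ → ℝ) (δ B : ℝ), 0 < δ → (∀ k, δ ≤ b k ∧ b k ≤ B) →
      Summable (fun k => 1 / (1 + (γ k) ^ 2)) →
      ∃ (E : ℂ → ℂ) (φ : ℝ → ℝ) (C : ℝ) (N : ℕ), IsHermiteBiehler E ∧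
        (∀ z : ℂ, -(δ / 2) ≤ z.im → E z ≠ 0) ∧
        (∀ z : ℂ, -(δ / 2) ≤ z.im → ‖deriv E z / E z‖ ≤ C * (1 + ‖z‖) ^ N) ∧
        (∀ t : ℝ, E t = ((‖E t‖ : ℝ) : ℂ) * cexp (-(((φ t : ℝ) : ℂ) * I))) ∧
        (∀ t : ℝ, -(deriv E t / E t).im = ∑' k, b k / ((t - γ k) ^ 2 + (b k) ^ 2)) ∧
        (∀ u v : ℝ, φ v - φ u = ∫ t in u..v, ∑' k, b k / ((t - γ k) ^ 2 + (b k) ^ 2)) :=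
  Summit.RiemannHypothesis.RiemannHypothesis.Theorems.SpectralTraceWindowTraceArch.stub_structureFunction

/-! ### The new stubs 4a–4d (the ONLY `sorry`s of this file) -/

/-- **STUB 4a (`stub_xiAbsorption`, size M–L): ξ absorbs the Weil distribution on the window.**
For `h > 1/2` and every Weil test `g` supported in `[−log 2, log 2]`:
`(1/π) ∫ ĝ(1/2+it) Re(ξ'/ξ)(1/2+h+it) dt = W(g) − ∫ g(x) m_h(x) dx`,
`m_h(x) = (1 − e^{−h|x|})(2cosh(x/2) − e^{−|x|/2}/(1 − e^{−2|x|}))`.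
Proof route (x-space, no zeros of ζ): `ξ'/ξ(s) = 1/s + 1/(s−1) − (log π)/2 + ψ(s/2)/2 − Σ Λ(n)n^{−s}`
(`logDeriv_riemannXi_eq_of_one_lt_re`); polar pieces are Poisson kernels at `0` of widths `h ± 1/2`
(`stub_smearedWindowFormula_atom`: `∫ g e^{−b|x|}`); the digamma piece is the tree's Bombieri computation
(`WeilExplicitArchTermProofs`) with `1/4 ↦ 1/4 + h/2` (digamma series + `integral_weilMellin_vertical_div_sub`);
the von Mangoldt piece vanishes: `(1/π)∫ ĝ(t) n^{−it}… = g(±log n) = 0` on the closed window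
(`integral_weilMellin_vertical_mul_natCast_cpow`); compare with `weilArchTermBombieri_eq_weilArchTerm_holds`
(the `g(0)` constants cancel: `2 log 2 − log 4 = 0`). -/
theorem stub_xiAbsorption :
    ∀ (h : ℝ), 1 / 2 < h → ∀ g : ℝ → ℂ, IsWeilTest g → tsupport g ⊆ Icc (-Real.log 2) (Real.log 2) →
      (1 / (π : ℂ)) * ∫ t : ℝ, weilMellin g (1 / 2 + (t : ℂ) * I) *
          (((deriv riemannXi (1 / 2 + h + t * I) / riemannXi (1 / 2 + h + t * I)).re : ℝ) : ℂ)
        = weilFunctional g - ∫ x : ℝ, g x *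
          (((1 - Real.exp (-(h * |x|))) *
            (2 * Real.cosh (x / 2) - Real.exp (-(|x| / 2)) / (1 - Real.exp (-(2 * |x|)))) : ℝ) : ℂ) :=
  Summit.RiemannHypothesis.RiemannHypothesis.Theorems.SpectralTraceWindowTraceArch.stub_xiAbsorption

/-- **STUB 4b (`stub_xiPhase`, size M): growth and phase of the shifted ξ.** For `h > 1/2`:
(i) `ξ'/ξ(s)` is at most linear on `Re s ≥ 3/4 + h/2` (`> 1`: `logDeriv_riemannXi_eq_of_one_lt_re`,
a digamma bound of `exists_norm_digamma_vertical_le` type, `‖L(Λ, s)‖ ≤ Σ Λ(n) n^{−Re s}`);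
(ii) a continuous phase `φ` of `t ↦ ξ(1/2 + h − it)` with `ξ(1/2+h−it) = |…| e^{−iφ(t)}` and
`φ(v) − φ(u) = ∫ᵤᵛ Re(ξ'/ξ)(1/2+h+it) dt` (zero-derivative argument as in `causalCLS_phase`;
`Re ξ'/ξ(1/2+h−it) = Re ξ'/ξ(1/2+h+it)` by `logDeriv_riemannXi_conj`). -/
theorem stub_xiPhase :
    ∀ (h : ℝ), 1 / 2 < h →
      (∃ C : ℝ, ∀ s : ℂ, 3 / 4 + h / 2 ≤ s.re →
        ‖deriv riemannXi s / riemannXi s‖ ≤ C * (1 + ‖s‖)) ∧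
      (∃ φ : ℝ → ℝ, (∀ t : ℝ, riemannXi (1 / 2 + h - I * t) =
          ((‖riemannXi (1 / 2 + h - I * t)‖ : ℝ) : ℂ) * cexp (-(((φ t : ℝ) : ℂ) * I))) ∧
        (∀ u v : ℝ, φ v - φ u =
          ∫ t in u..v, (deriv riemannXi (1 / 2 + h + t * I) / riemannXi (1 / 2 + h + t * I)).re)) :=
  Summit.RiemannHypothesis.RiemannHypothesis.Theorems.SpectralTraceWindowTraceArch.stub_xiPhase

/-- **STUB 4d (`stub_smearedIntegrable`, size S–M): integrability bookkeeping.** For a configuration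
with widths in `[δ, B]`, `Σ 1/(1+γ_k²) < ∞`, any real `c` and any Weil test `g`, the integrand
`ĝ(1/2+it) · (c + Σ_k b_k/((t−γ_k)²+b_k²))` of the smeared window formula is Lebesgue integrable
(Peetre bound `stub_smearedWindowFormula_poisson_le` + decay `stub_smearedWindowFormula_decay`). -/
theorem stub_smearedIntegrable :
    ∀ (γ b : ℕ → ℝ) (δ B c : ℝ), 0 < δ → (∀ k, δ ≤ b k ∧ b k ≤ B) →
      Summable (fun k => 1 / (1 + (γ k) ^ 2)) →
      ∀ g : ℝ → ℂ, IsWeilTest g →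
        Integrable (fun t : ℝ => weilMellin g (1 / 2 + (t : ℂ) * I) *
          (((c + ∑' k, b k / ((t - γ k) ^ 2 + (b k) ^ 2) : ℝ)) : ℂ)) :=
  Summit.RiemannHypothesis.RiemannHypothesis.Theorems.SpectralTraceWindowTraceArch.stub_smearedIntegrable

/-! ### Glue -/

/-- Level-set membership is phase integrality: if `E(t) = |E(t)| e^{-iφ(t)}` with `E(t) ≠ 0`, then
`Im (e^{i(α - Lt)} E(t)) = 0 ↔ ∃ n : ℤ, L t + φ t = α + n π`. -/
theorem im_tilt_eq_zero_iff {E : ℂ → ℂ} {φ : ℝ → ℝ} {α L t : ℝ}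
    (hpolar : E t = ((‖E t‖ : ℝ) : ℂ) * cexp (-(((φ t : ℝ) : ℂ) * I))) (hne : E t ≠ 0) :
    (cexp (((α - L * t : ℝ) : ℂ) * I) * E t).im = 0 ↔ ∃ n : ℤ, L * t + φ t = α + n * π := by
  have e : cexp (((α - L * t : ℝ) : ℂ) * I) * E t =
      ((‖E t‖ : ℝ) : ℂ) * cexp (((α - L * t - φ t : ℝ) : ℂ) * I) := by
    conv_lhs => rw [hpolar]
    rw [mul_left_comm, ← Complex.exp_add]
    congr 2
    push_cast
    ring
  rw [e, Complex.im_ofReal_mul, Complex.exp_ofReal_mul_I_im]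
  have hn : ‖E t‖ ≠ 0 := norm_ne_zero_iff.2 hne
  constructor
  · intro h0
    have hs : Real.sin (α - L * t - φ t) = 0 := by
      rcases mul_eq_zero.1 h0 with h | h
      · exact absurd h hn
      · exact h
    obtain ⟨n, hn'⟩ := Real.sin_eq_zero_iff.1 hs
    exact ⟨-n, by push_cast; linarith⟩
  · rintro ⟨n, hn'⟩
    have : α - L * t - φ t = ((-n : ℤ) : ℝ) * π := by push_cast; linarith
    rw [this, Real.sin_int_mul_pi, mul_zero]

/-- Product of Hermite–Biehler functions is Hermite–Biehler. -/
theorem isHermiteBiehler_mul {E F : ℂ → ℂ} (hE : IsHermiteBiehler E) (hF : IsHermiteBiehler F) :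
    IsHermiteBiehler (fun z => E z * F z) where
  differentiable := hE.differentiable.mul hF.differentiable
  norm_conj_lt := fun z hz => by
    simp only [norm_mul]
    exact mul_lt_mul'' (hE.norm_conj_lt z hz) (hF.norm_conj_lt z hz) (norm_nonneg _) (norm_nonneg _)

/-- The shifted ξ, `F_h(z) = ξ(1/2 + h − iz)`, is Hermite–Biehler for `h ≥ 1/2` (Lagarias 2005,
Lemma 2.1, proved in the tree). -/
theorem isHermiteBiehler_xiShift {h : ℝ} (hh : 1 / 2 ≤ h) :
    IsHermiteBiehler (fun z : ℂ => riemannXi (1 / 2 + h - I * z)) where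
  differentiable := differentiable_riemannXi.comp
    ((differentiable_const _).sub ((differentiable_const _).mul differentiable_id))
  norm_conj_lt := fun _ hz =>
    lagarias2005_lemma_2_1.structureFunction lagarias2005_lemma_2_1_holds hh hz


/-! ### Lead c2 reshaping (cycle 1): the composition is factored through two TRACE stubs

* `stub_carrierTrace` (TRUE, size M; provable now from stubs 1, 2, 3, 4a, 4b, 4d exactly as in lead c1's
  composition): for every smeared configuration `R`, shift `h > 1/2`, tilt `L` with `log 2 < 2L` and anchor `α`,
  the PHASE level set `{t : L t + ∫₀ᵗ Re ξ'/ξ(1/2+h+ix) dx + ∫₀ᵗ ΣP_R ∈ α + πℤ}` (= a level set of the tilted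
  Hermite–Biehler function `e^{-iLz} ξ(1/2+h-iz) E_R(z)`) is an EXACT, UNCONDITIONAL unit-atomic real trace
  formula for the damped-and-shifted functional: `Σ ĝ = W(g) − ∫ g m_h + 2L g(0) + Σ_R ∫ g e^{iγx−b|x|}`.
* `stub_excisedTrace` (TRUE, size S–M): the same for a configuration alone (no ξ factor):
  `Σ_{L t + ∫₀ᵗ ΣP_G ∈ β+πℤ} ĝ = 2L g(0) + Σ_G ∫ g e^{iγx−b|x|}`.
* `stub_doublyTiltedDesign` (unchanged; HARDEST; crux-complete by the cell law of Cruxes/WindowTraceArch/NOTES.md §4).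
The composition below uses only these three, by name. -/

/-- **STUB T1 (`stub_carrierTrace`, LANDED p125130): the ξ-carrier trace formula in phase form.**
For a smeared configuration `R = (γ, b)` (widths in `[δ, B]`, `Σ 1/(1+γ²) < ∞`), `h > 1/2`, `log 2 < 2L`, `α ∈ ℝ`:
the real set `{t : ∃ m : ℤ, L t + ∫₀ᵗ Re ξ'/ξ(1/2+h+ix) dx + ∫₀ᵗ Σ_k b_k/((x−γ_k)²+b_k²) dx = α + mπ}` sums `ĝ(1/2+it)`
(unconditionally, `HasSum`) to `W(g) − ∫ g m_h + 2L g(0) + Σ_k ∫ g(x) e^{iγ_k x − b_k|x|} dx` for every Weil test `g`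
supported in `[−log 2, log 2]`. Proof = the `E`-half of lead c1's composition: `E := ξ(1/2+h−iz)·E_R` (stub 3,
`isHermiteBiehler_xiShift`, `isHermiteBiehler_mul`), zero-free strip and growth (stub 4b), CLS (stub 1) at anchor
`α + φ_F(0) + φ_R(0)`, split of the integral (stubs 4d, 2, 4a), `im_tilt_eq_zero_iff` + `Equiv.subtypeEquivRight`. -/
theorem stub_carrierTrace :
    ∀ (γ b : ℕ → ℝ) (δ B h L α : ℝ), 0 < δ → (∀ k, δ ≤ b k ∧ b k ≤ B) →
      Summable (fun k => 1 / (1 + (γ k) ^ 2)) → 1 / 2 < h → Real.log 2 < 2 * L →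
      ∀ g : ℝ → ℂ, IsWeilTest g → tsupport g ⊆ Icc (-Real.log 2) (Real.log 2) →
        HasSum
          (fun l : {t : ℝ // ∃ m : ℤ, L * t + (∫ x in (0 : ℝ)..t,
              (deriv riemannXi (1 / 2 + h + x * I) / riemannXi (1 / 2 + h + x * I)).re)
                + (∫ x in (0 : ℝ)..t, ∑' k, b k / ((x - γ k) ^ 2 + (b k) ^ 2)) = α + m * π} =>
            weilMellin g (1 / 2 + ((l : ℝ) : ℂ) * I))
          (weilFunctional g
            - (∫ x : ℝ, g x *
                (((1 - Real.exp (-(h * |x|))) *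
                  (2 * Real.cosh (x / 2) - Real.exp (-(|x| / 2)) / (1 - Real.exp (-(2 * |x|)))) : ℝ) : ℂ))
            + 2 * L * g 0
            + ∑' k, ∫ x : ℝ, g x * cexp (((γ k * x : ℝ) : ℂ) * I) * ((Real.exp (-(b k * |x|)) : ℝ) : ℂ)) :=
  Summit.RiemannHypothesis.RiemannHypothesis.Theorems.SpectralTraceWindowTraceArch.stub_carrierTrace

/-- **STUB T2 (`stub_excisedTrace`, LANDED p125433): the configuration trace formula in phase form.**
For a smeared configuration `G = (γ, b)` (widths in `[δ, B]`, `Σ 1/(1+γ²) < ∞`), `log 2 < 2L`, `β ∈ ℝ`: the real set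
`{t : ∃ n : ℤ, L t + ∫₀ᵗ Σ_k b_k/((x−γ_k)²+b_k²) dx = β + nπ}` sums `ĝ(1/2+it)` to `2L g(0) + Σ_k ∫ g e^{iγ_k x − b_k|x|}`
for every window Weil test `g`. Proof = the `G`-half of lead c1's composition: stub 3 (structure function `E_G`,
phase `φ_G`), CLS (stub 1) at anchor `β + φ_G(0)`, stub 2, `im_tilt_eq_zero_iff` + `Equiv.subtypeEquivRight`. -/
theorem stub_excisedTrace :
    ∀ (γ b : ℕ → ℝ) (δ B L β : ℝ), 0 < δ → (∀ k, δ ≤ b k ∧ b k ≤ B) →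
      Summable (fun k => 1 / (1 + (γ k) ^ 2)) → Real.log 2 < 2 * L →
      ∀ g : ℝ → ℂ, IsWeilTest g → tsupport g ⊆ Icc (-Real.log 2) (Real.log 2) →
        HasSum
          (fun l : {t : ℝ // ∃ n : ℤ, L * t
              + (∫ x in (0 : ℝ)..t, ∑' k, b k / ((x - γ k) ^ 2 + (b k) ^ 2)) = β + n * π} =>
            weilMellin g (1 / 2 + ((l : ℝ) : ℂ) * I))
          (2 * L * g 0
            + ∑' k, ∫ x : ℝ, g x * cexp (((γ k * x : ℝ) : ℂ) * I) * ((Real.exp (-(b k * |x|)) : ℝ) : ℂ)) :=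
  Summit.RiemannHypothesis.RiemannHypothesis.Theorems.SpectralTraceWindowTraceArch.stub_excisedTrace

/-- **STUB 4c (`stub_doublyTiltedDesign`, size XL — HARDEST, the reshaped Transfer C⁺).** There are two
configurations `R = (γR, bR)`, `G = (γG, bG)` (widths in `[δ, B]`, `Σ 1/(1+γ²) < ∞`), a shift `h > 1/2`,
a tilt `L` with `log 2 < 2L` and anchors `α, β` such that
(a) INCLUSION: every `s` with `L s + ∫₀ˢ ΣP_G ∈ β + πℤ` (a level point of the tilted `G`) satisfies
`L s + ∫₀ˢ Re ξ'/ξ(1/2+h+it) dt + ∫₀ˢ ΣP_R ∈ α + πℤ` (it is a level point of `e^{−iLz}ξ_h E_R`), and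
(b) SYNTHESIS: `Σ_R ∫ g e^{iγx−b|x|} − Σ_G ∫ g e^{iγx−b|x|} = ∫ g m_h` for every window Weil test `g`.
Bookkeeping (work/stub4_analysis.md §3): bottom `|t| ≲ 13` with no witness atoms (`k = 1`, consistent
with `|γ| ≥ 11`, Disproof §4), far field `k = 2` with `ρ_R ≈ ρ_G ≈ (φ_h' − L)/π` plus invisible
modulations carrying the per-cell integrality; knobs/equations per unit `t` → 4. -/
theorem stub_doublyTiltedDesign :
    ∃ (γR bR γG bG : ℕ → ℝ) (δ B h L α β : ℝ),
      0 < δ ∧ (∀ k, δ ≤ bR k ∧ bR k ≤ B) ∧ (∀ k, δ ≤ bG k ∧ bG k ≤ B) ∧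
      Summable (fun k => 1 / (1 + (γR k) ^ 2)) ∧ Summable (fun k => 1 / (1 + (γG k) ^ 2)) ∧
      1 / 2 < h ∧ Real.log 2 < 2 * L ∧
      (∀ s : ℝ, (∃ n : ℤ, L * s + ∫ t in (0 : ℝ)..s, ∑' k, bG k / ((t - γG k) ^ 2 + (bG k) ^ 2)
            = β + n * π) →
        ∃ m : ℤ, L * s + (∫ t in (0 : ℝ)..s,
            (deriv riemannXi (1 / 2 + h + t * I) / riemannXi (1 / 2 + h + t * I)).re)
              + (∫ t in (0 : ℝ)..s, ∑' k, bR k / ((t - γR k) ^ 2 + (bR k) ^ 2)) = α + m * π) ∧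
      (∀ g : ℝ → ℂ, IsWeilTest g → tsupport g ⊆ Icc (-Real.log 2) (Real.log 2) →
        (∑' k, ∫ x : ℝ, g x * cexp (((γR k * x : ℝ) : ℂ) * I) * ((Real.exp (-(bR k * |x|)) : ℝ) : ℂ)) -
        (∑' k, ∫ x : ℝ, g x * cexp (((γG k * x : ℝ) : ℂ) * I) * ((Real.exp (-(bG k * |x|)) : ℝ) : ℂ))
          = ∫ x : ℝ, g x *
            (((1 - Real.exp (-(h * |x|))) *
              (2 * Real.cosh (x / 2) - Real.exp (-(|x| / 2)) / (1 - Real.exp (-(2 * |x|)))) : ℝ) : ℂ)) := by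
  sorry

/-! ### The composition -/

/-- **The composition, hypotheses-free form**: the two trace stubs and the design stub prove the crux body. -/
theorem windowTrace_of_reshaped :
    ∃ (ι : Type) (γ : ι → ℝ), ∀ g : ℝ → ℂ, IsWeilTest g →
      tsupport g ⊆ Icc (-Real.log 2) (Real.log 2) →
        HasSum (fun i => weilMellin g (1 / 2 + (γ i : ℂ) * I)) (weilFunctional g) := by
  classical
  obtain ⟨γR, bR, γG, bG, δ, B, h, L, α, β, hδ, hbR, hbG, hsR, hsG, hh, hL, hincl, hsyn⟩ :=
    stub_doublyTiltedDesign
  -- the two phase level-set predicates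
  let PE : ℝ → Prop := fun t => ∃ m : ℤ, L * t + (∫ x in (0 : ℝ)..t,
      (deriv riemannXi (1 / 2 + h + x * I) / riemannXi (1 / 2 + h + x * I)).re)
        + (∫ x in (0 : ℝ)..t, ∑' k, bR k / ((x - γR k) ^ 2 + (bR k) ^ 2)) = α + m * π
  let PG : ℝ → Prop := fun t => ∃ n : ℤ, L * t
      + (∫ x in (0 : ℝ)..t, ∑' k, bG k / ((x - γG k) ^ 2 + (bG k) ^ 2)) = β + n * π
  have hsub : ∀ t : ℝ, PG t → PE t := fun t ht => hincl t ht
  -- the witness: carrier level points that are not excised level points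
  let X := {t : ℝ // PE t}
  let S : Set X := {l | PG l.val}
  refine ⟨↥(Sᶜ), fun i => ((i : X) : ℝ), fun g hg hgs => ?_⟩
  have hE := stub_carrierTrace γR bR δ B h L α hδ hbR hsR hh hL g hg hgs
  have hG := stub_excisedTrace γG bG δ B L β hδ hbG hsG hL g hg hgs
  set TG : ℂ := ∑' k, ∫ x : ℝ, g x * cexp (((γG k * x : ℝ) : ℂ) * I) *
    ((Real.exp (-(bG k * |x|)) : ℝ) : ℂ) with hTG
  set TR : ℂ := ∑' k, ∫ x : ℝ, g x * cexp (((γR k * x : ℝ) : ℂ) * I) *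
    ((Real.exp (-(bR k * |x|)) : ℝ) : ℂ) with hTR
  set Mh : ℂ := ∫ x : ℝ, g x * (((1 - Real.exp (-(h * |x|))) *
    (2 * Real.cosh (x / 2) - Real.exp (-(|x| / 2)) / (1 - Real.exp (-(2 * |x|)))) : ℝ) : ℂ) with hMh
  have hsyn' : TR - TG = Mh := hsyn g hg hgs
  -- transport the `G` sum to the subset `S` of the carrier level set, then take the complement
  let F0 : X → ℂ := fun l => weilMellin g (1 / 2 + (((l : ℝ)) : ℂ) * I)
  let e : {t : ℝ // PG t} ≃ S :=
    { toFun := fun t => ⟨⟨t.1, hsub t.1 t.2⟩, t.2⟩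
      invFun := fun l => ⟨l.1.1, l.2⟩
      left_inv := fun _ => rfl
      right_inv := fun _ => rfl }
  have hGS : HasSum (F0 ∘ (↑) : S → ℂ) (2 * L * g 0 + TG) := (Equiv.hasSum_iff e).1 hG
  have hE' : HasSum F0 (2 * L * g 0 + TG + weilFunctional g) := by
    have : weilFunctional g - Mh + 2 * L * g 0 + TR = 2 * L * g 0 + TG + weilFunctional g := by
      linear_combination hsyn'
    rw [← this]; exact hE
  exact (hGS.hasSum_compl_iff (a₂ := weilFunctional g)).2 hE'

/-- **`WindowTraceArch_of`** — the crux BY NAME from the reshaped stubs. -/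
theorem WindowTraceArch_of :
    Summit.RiemannHypothesis.RiemannHypothesis.Theses.SpectralTrace.WindowTraceArch :=
  windowTrace_of_reshaped

end Summit.RiemannHypothesis.RiemannHypothesis.Cruxes.WindowTraceArch.CausalLevelSets

end
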